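import Summits.Ventures.CertifiedArithmetic.LowPrec.DoubleRoundingDivisionEqualPrecision

/-!
# Double rounding of quotients on the strip `P_φ < P_ψ < 2 P_φ` (THEOREM N-div-S)

HONEST FRAMING (venture CertifiedArithmetic / cell `pub-lowprec`): certified error envelopes and
provably optimal rounding/accumulation schemes for low-precision formats under stated cost models;
every table by two implementations; no hardware or vendor claims.

The quotient clause (Q) of `drDiv_of_clause` (`DoubleRoundingDivision.lean`) makes the double
rounding `fl_φ (fl_ψ (a / b))` of `φ`-quotients innocuous for `P_ψ ≥ 2 P_φ` (plus a quantum and a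
range condition), and `not_drDiv_strip` (`DoubleRoundingStripLaws.lean`, THEOREM N-strip (÷))
already shows the strip `P_φ < P_ψ < 2 P_φ` never innocuous for NESTED records with biases `≥ 1`,
by Figueroa's quotient `4 / (2 - 2^(1-P))`.  This file RESTATES that strip law with the same
witness family placed in a free binade (exponents `k`, `c`; no bias and no range-nesting
hypothesis), so that it becomes a boolean test on records (§2), and — with THEOREM N-div-E of
`DoubleRoundingDivisionEqualPrecision.lean` — closes the classification of the named ÷ matrix
(§3), which is the point of the file.

* §1 THEOREM N-div-S (`not_drDiv_of_strip`): `quantum ψ ∣ quantum φ`, `P_φ < P_ψ < 2 P_φ`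
  (`P = m + 1`), and the data `a = 2^n`, `b = (2^P - 1)·2^c` quanta of `φ` in range with
  `2^n = 2^(2P+k+c)·quantum φ` (plus the window `2^(P+k) + 2^(k+1) ≤ M_φ`, the intermediate value
  in range of `ψ`, and `P_ψ ≤ P + k + (L_φ - L_ψ)`) `⟹ ¬ DRDiv φ ψ`:
  `a / b = 2^(P+k)·2^P/(2^P - 1)·q_φ = (2^(P+k) + 2^k)·q_φ + 2^k·q_φ/(2^P - 1)` lies just above the
  midpoint `y = (2^(P+k) + 2^k)·q_φ` of the data `2^(P+k)·q_φ < (2^(P+k) + 2^(k+1))·q_φ`; `y` has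
  `P + 1 ≤ P_ψ` significant bits, so it is a value of `ψ`, and the excess `2^k q_φ/(2^P - 1)` is
  below half the spacing `2^(P+k-P_ψ+1)·q_φ` of `ψ` there because `P_ψ < 2P`: `fl_ψ (a/b) = y`,
  `fl_φ y = 2^(P+k)·q_φ` (tie to even), `fl_φ (a/b) = (2^(P+k) + 2^(k+1))·q_φ`.  This is
  Figueroa's optimality example `(2^P)² / (2^P - 1)` [Figueroa1995, §3] ([Roux2014, Remark after
  Thm. for division], the `(8, 15)` example), transplanted to EVERY strip column and to saturating
  records with subnormals (`k`, `c` absorb the exponent range; `not_drDiv_strip` is the instance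
  `a = 4` under range nesting).
* §2 ON THE NAMED RECORDS the hypothesis (canonical `k = max (0, P_ψ - P - 1 - (L_φ - L_ψ))`,
  `c = max (0, -(2P + k + L_φ))`; boolean test `drDivStripTest`) holds on exactly `10` cells: `9`
  failing embedded cells of `drDiv_named_iff` (e2m1 → e3m2 / e5m2 / binary8p3 / binary8p3f:
  `4 ÷ 3/2`; e3m2 → e4m3 / binary8p4 / binary8p4f: `1/4 ÷ 7/16`; e2m3 → binary8p5: `4 ÷ 15/8`;
  binary8p5 → bfloat16: `1/16 ÷ 31/128`) and the non-embedded e3m2 → binary8p5.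
* §3 CLASSIFICATION, COMPLETED (`drDiv_named_failing_classified`): every one of the `16` failing
  embedded cells of the named ÷ matrix satisfies the hypothesis of THEOREM N-div-S (`9` cells,
  `P_ψ ≤ 2P_φ - 1`) or of THEOREM N-div-E (`not_drDiv_of_equal_precision`, `7` cells, `P_ψ = P_φ`
  with a finer quantum), and no cell satisfies both: ALL failing cells are instances of two
  record-generic laws, none is a searched witness only (`not_drDiv_named_of_laws`); with
  `embeds_of_drDiv_named` the matrix reads `DRDiv X Y ↔ X ⊆ Y ∧ ¬S ∧ ¬E` (`drDiv_named_iff_laws`).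

Two implementations: A = `code/enum/div_necessity_laws.py` (exact rationals; the strip family on
the named cells and on pseudo-record strip pairs `2 ≤ P_φ ≤ 12`, two roundings each) →
`certs/enum/DOUBLE-ROUNDING-DIV-NECESSITY.json`; B = the kernel (this file).  PLACEMENT — KNOWN:
`p₂ ≥ 2p₁` is necessary for innocuous double rounding of quotients, by this very example
[Figueroa1995, §3; Roux2014, §2], record-generic in this tree since `not_drDiv_strip`; NEW here
only: the bias-free, binade-parametrised form as a decidable test on records and the closed
classification of the named matrix by two laws.  No hardware or vendor claims.
-/

namespace Summit.Ventures.CertifiedArithmetic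

open Literature.ComputerArithmetic.FloatingPoint
open Literature.ComputerArithmetic.FloatingPoint.Format
open Literature.ComputerArithmetic.FloatingPoint.MiniFloat

/-! ## §1 THEOREM N-div-S -/

/-- ROUNDING IN THE UPPER HALF-WINDOW: for `2^(P+k) + 2^(k+1) ≤ M_φ`, every rational `x` with
`(2^(P+k) + 2^k)·q < x ≤ (2^(P+k) + 2^(k+1))·q` rounds to `(2^(P+k) + 2^(k+1))·q` (no datum lies
strictly between `2^(P+k)·q` and `(2^(P+k) + 2^(k+1))·q`, `gap_above_pow`). [folklore] -/
theorem toRat_roundNE_of_gt_midpoint {φ : Format} {k : ℕ}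
    (hu : 2 ^ (φ.manBits + 1 + k) + 2 ^ (k + 1) ≤ φ.maxScaled) {x : ℚ}
    (hlo : ((2 ^ (φ.manBits + 1 + k) + 2 ^ k : ℕ) : ℚ) * φ.quantum < x)
    (hhi : x ≤ ((2 ^ (φ.manBits + 1 + k) + 2 ^ (k + 1) : ℕ) : ℚ) * φ.quantum) :
    (roundNE φ x).toRat = ((2 ^ (φ.manBits + 1 + k) + 2 ^ (k + 1) : ℕ) : ℚ) * φ.quantum := by
  have hq := φ.quantum_pos
  obtain ⟨hr0, hru⟩ := representable_pow_add hu
  obtain ⟨v0, hv0⟩ := exists_toRat_eq_natMul hr0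
  obtain ⟨yu, hyu⟩ := exists_toRat_eq_natMul hru
  have e2 : ((2 ^ (φ.manBits + 1 + k) + 2 ^ (k + 1) : ℕ) : ℚ) * φ.quantum
      = ((2 ^ (φ.manBits + 1 + k) + 2 ^ k : ℕ) : ℚ) * φ.quantum + 2 ^ k * φ.quantum := by
    push_cast; ring
  have e0 : ((2 ^ (φ.manBits + 1 + k) : ℕ) : ℚ) * φ.quantum
      = ((2 ^ (φ.manBits + 1 + k) + 2 ^ k : ℕ) : ℚ) * φ.quantum - 2 ^ k * φ.quantum := by
    push_cast; ring
  rw [e2] at hhi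
  rw [← hyu]
  apply toRat_roundNE_eq_of_forall_lt ⟨yu, rfl⟩
  intro y hy
  rcases gap_above_pow hv0 y with h | h
  · rw [e0] at h
    rw [hyu, e2, abs_of_nonpos (by linarith), abs_of_nonneg (by linarith)]
    linarith
  · rw [← hyu] at h
    have h' : yu.toRat < y.toRat := lt_of_le_of_ne h (Ne.symm hy)
    rw [hyu, e2] at h' ⊢
    rw [abs_of_nonpos (by linarith), abs_of_nonpos (by linarith)]
    linarith

/-- THEOREM N-div-S (the strip `P_φ < P_ψ < 2 P_φ` is never innocuous for division), for EVERY
pair of format records: `L_ψ ≤ L_φ`, `m + 1 ≤ m_ψ ≤ 2m` (`m = m_φ`), the data `a = 2^n` and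
`b = (2^(m+1) - 1)·2^c` quanta of `φ` in range with `n = 2m + 2 + k + c + L_φ`, the window
`2^(m+1+k) + 2^(k+1) ≤ M_φ`, `(2^(m+1) + 1)·2^(k + L_φ - L_ψ) ≤ M_ψ` and
`m_ψ ≤ m + 1 + k + (L_φ - L_ψ)` `⟹ ¬ DRDiv φ ψ`, by
`a / b = (2^(m+1+k) + 2^k + 2^k/(2^(m+1) - 1))·q_φ`:
`fl_ψ (a/b) = (2^(m+1+k) + 2^k)·q_φ ↦ 2^(m+1+k)·q_φ`, directly `(2^(m+1+k) + 2^(k+1))·q_φ`.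
(`not_drDiv_strip` of `DoubleRoundingStripLaws` is the member `a = 4` of this family, stated under
range nesting and biases `≥ 1`.) [this packet; cite: Figueroa1995, §3; cite: Roux2014, §2] -/
theorem not_drDiv_of_strip {φ ψ : Format} (hq : ψ.qexp ≤ φ.qexp) (hlo : φ.manBits + 1 ≤ ψ.manBits)
    (hhi : ψ.manBits ≤ 2 * φ.manBits) {k c n : ℕ}
    (hn : (n : ℤ) = 2 * φ.manBits + 2 + k + c + φ.qexp) (ha : 2 ^ n ≤ φ.maxScaled)
    (hb : (2 ^ (φ.manBits + 1) - 1) * 2 ^ c ≤ φ.maxScaled)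
    (hu : 2 ^ (φ.manBits + 1 + k) + 2 ^ (k + 1) ≤ φ.maxScaled)
    (hy : (2 ^ (φ.manBits + 1) + 1) * 2 ^ (k + (φ.qexp - ψ.qexp).toNat) ≤ ψ.maxScaled)
    (he : ψ.manBits ≤ φ.manBits + 1 + k + (φ.qexp - ψ.qexp).toNat) : ¬ DRDiv φ ψ := by
  intro hD
  have hq0 := φ.quantum_pos
  have hq1 := ψ.quantum_pos
  have h1 : 1 ≤ φ.manBits := by omega
  have hm2 : 2 ≤ 2 ^ φ.manBits := le_trans (by norm_num) (Nat.pow_le_pow_right (by norm_num) h1)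
  have hpow : 2 ^ (φ.manBits + 1) = 2 * 2 ^ φ.manBits := pow_succ' 2 _
  set d := (φ.qexp - ψ.qexp).toNat with hd
  have hQ : φ.quantum = 2 ^ d * ψ.quantum := quantum_eq_two_pow_mul hq
  -- the exponent bookkeeping of `ψ`: `m_ψ = m + 1 + g`, spacing `2^e` quanta of `ψ` at `y`
  obtain ⟨g, hg⟩ : ∃ g, ψ.manBits = φ.manBits + 1 + g := ⟨ψ.manBits - φ.manBits - 1, by omega⟩
  obtain ⟨e, heg⟩ : ∃ e, k + d = g + e := ⟨k + d - g, by omega⟩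
  have hke : (2 : ℚ) ^ k * 2 ^ d = 2 ^ g * 2 ^ e := by rw [← pow_add, ← pow_add, heg]
  -- data
  have haR : φ.Representable (2 ^ n) := by
    simpa using representable_mul_pow (φ := φ) (k := 1) (j := n) (by omega) (by simpa using ha)
  obtain ⟨a, ha'⟩ := exists_toRat_eq_natMul haR
  obtain ⟨b, hb'⟩ := exists_toRat_eq_natMul
    (representable_mul_pow (φ := φ) (k := 2 ^ (φ.manBits + 1) - 1) (j := c) (by omega) hb)
  have hN4 : (4 : ℚ) ≤ 2 ^ (φ.manBits + 1) := by
    exact_mod_cast (show 4 ≤ 2 ^ (φ.manBits + 1) by omega)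
  have hNpos : (0 : ℚ) < 2 ^ (φ.manBits + 1) - 1 := by linarith
  -- the quotient
  have hquot : a.toRat / b.toRat = ((2 ^ (φ.manBits + 1 + k) + 2 ^ k : ℕ) : ℚ) * φ.quantum
      + 2 ^ k * φ.quantum / (2 ^ (φ.manBits + 1) - 1) := by
    have hB : (((2 ^ (φ.manBits + 1) - 1) * 2 ^ c : ℕ) : ℚ)
        = (2 ^ (φ.manBits + 1) - 1) * 2 ^ c := by
      rw [Nat.cast_mul, Nat.cast_sub Nat.one_le_two_pow]; push_cast; ring
    rw [ha', hb', hB]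
    push_cast
    rw [two_pow_eq_two_pow_mul_quantum (k := 2 * φ.manBits + 2 + k + c) (by push_cast; omega)]
    have hNne : (2 : ℚ) ^ (φ.manBits + 1) - 1 ≠ 0 := hNpos.ne'
    field_simp
    ring
  -- the intermediate value `y = (2^(m+1+k) + 2^k)·q_φ` on the grid of `ψ`
  have hyv : ((2 ^ (φ.manBits + 1 + k) + 2 ^ k : ℕ) : ℚ) * φ.quantum
      = (((2 ^ (φ.manBits + 1) + 1) * 2 ^ g * 2 ^ e : ℕ) : ℚ) * ψ.quantum := by
    rw [hQ]; push_cast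
    linear_combination ((2 : ℚ) ^ (φ.manBits + 1) + 1) * ψ.quantum * hke
  have hY : (roundNE ψ (a.toRat / b.toRat)).toRat
      = ((2 ^ (φ.manBits + 1 + k) + 2 ^ k : ℕ) : ℚ) * φ.quantum := by
    rw [hquot, hyv]
    refine toRat_roundNE_full_add_small ?_ ?_ ?_ (div_nonneg (by positivity) hNpos.le) ?_
    · rw [show 2 ^ ψ.manBits = 2 ^ (φ.manBits + 1) * 2 ^ g by rw [hg]; ring]
      exact Nat.mul_le_mul_right _ (by omega)
    · rw [show 2 ^ (ψ.manBits + 1) = (2 ^ (φ.manBits + 1) + 2 ^ (φ.manBits + 1)) * 2 ^ g by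
        rw [hg]; ring]
      exact Nat.mul_lt_mul_of_pos_right (by omega) (by positivity)
    · rw [mul_assoc, ← pow_add, ← heg]; exact hy
    · have hg1 : (2 : ℚ) * 2 ^ g < 2 ^ (φ.manBits + 1) - 1 := by
        have h' : 2 * 2 ^ g + 1 < 2 ^ (φ.manBits + 1) := by
          have : 2 ^ (g + 1) ≤ 2 ^ φ.manBits := Nat.pow_le_pow_right (by norm_num) (by omega)
          rw [pow_succ] at this; omega
        have h'' : ((2 * 2 ^ g + 1 : ℕ) : ℚ) < ((2 ^ (φ.manBits + 1) : ℕ) : ℚ) := by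
          exact_mod_cast h'
        push_cast at h''; linarith
      have hpos : (0 : ℚ) < 2 ^ e * ψ.quantum := by positivity
      have key : 2 * (2 ^ k * φ.quantum) = (2 * 2 ^ g) * (2 ^ e * ψ.quantum) := by
        rw [hQ]; linear_combination 2 * ψ.quantum * hke
      rw [← mul_div_assoc, key, div_lt_iff₀ hNpos]
      nlinarith [mul_lt_mul_of_pos_right hg1 hpos]
  -- the two roundings in `φ`
  have hX1 := toRat_roundNE_midpoint h1 hu
  have hX2 : (roundNE φ (a.toRat / b.toRat)).toRat
      = ((2 ^ (φ.manBits + 1 + k) + 2 ^ (k + 1) : ℕ) : ℚ) * φ.quantum := by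
    rw [hquot]
    have hδ : (0 : ℚ) < 2 ^ k * φ.quantum / (2 ^ (φ.manBits + 1) - 1) :=
      div_pos (by positivity) hNpos
    have hδ' : 2 ^ k * φ.quantum / (2 ^ (φ.manBits + 1) - 1) ≤ 2 ^ k * φ.quantum :=
      div_le_self (by positivity) (by linarith)
    have e2 : ((2 ^ (φ.manBits + 1 + k) + 2 ^ (k + 1) : ℕ) : ℚ) * φ.quantum
        = ((2 ^ (φ.manBits + 1 + k) + 2 ^ k : ℕ) : ℚ) * φ.quantum + 2 ^ k * φ.quantum := by
      push_cast; ring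
    exact toRat_roundNE_of_gt_midpoint hu (by linarith) (by rw [e2]; linarith)
  have := hD a b
  rw [hY, hX1, hX2] at this
  push_cast at this
  have h2 : (0 : ℚ) < 2 ^ (k + 1) * φ.quantum := by positivity
  have := mul_right_cancel₀ hq0.ne' this
  linarith

/-! ## §2 The named records -/

/-- THE HYPOTHESIS OF THEOREM N-div-S AS A BOOLEAN TEST on parameter records, with the canonical
exponents `k = max (0, m_Y - m_X - 1 - (L_X - L_Y))` (the intermediate value normal in `Y`) and
`c = max (0, -(2 m_X + 2 + k + L_X))` (the dividend an integer number of quanta). [this packet] -/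
def drDivStripTest (X Y : Format) : Bool :=
  let d := (X.qexp - Y.qexp).toNat
  let k := Y.manBits - X.manBits - 1 - d
  let c := (-(2 * (X.manBits : ℤ) + 2 + k + X.qexp)).toNat
  let n := (2 * (X.manBits : ℤ) + 2 + k + c + X.qexp).toNat
  decide (Y.qexp ≤ X.qexp) && decide (X.manBits + 1 ≤ Y.manBits) &&
  decide (Y.manBits ≤ 2 * X.manBits) && decide (2 ^ n ≤ X.maxScaled) &&
  decide ((2 ^ (X.manBits + 1) - 1) * 2 ^ c ≤ X.maxScaled) &&
  decide (2 ^ (X.manBits + 1 + k) + 2 ^ (k + 1) ≤ X.maxScaled) &&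
  decide ((2 ^ (X.manBits + 1) + 1) * 2 ^ (k + d) ≤ Y.maxScaled) &&
  decide (Y.manBits ≤ X.manBits + 1 + k + d)

/-- SOUNDNESS OF THE TEST: `drDivStripTest X Y ⟹ ¬ DRDiv X Y` (THEOREM N-div-S at the canonical
exponents). [this packet] -/
theorem not_drDiv_of_stripTest {X Y : Format} (h : drDivStripTest X Y = true) : ¬ DRDiv X Y := by
  simp only [drDivStripTest, Bool.and_eq_true, decide_eq_true_eq] at h
  obtain ⟨⟨⟨⟨⟨⟨⟨hq, hlo⟩, hhi⟩, ha⟩, hb⟩, hu⟩, hy⟩, he⟩ := h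
  exact not_drDiv_of_strip hq hlo hhi (by omega) ha hb hu hy he

/-- ON THE NAMED `13 × 13` MATRIX the test holds on exactly `10` cells: `9` failing embedded cells
of `drDiv_named_iff` and the non-embedded e3m2 → binary8p5 (all with `k = c = 0`). [this packet] -/
theorem drDivStrip_named_iff : ∀ X ∈ namedFormats, ∀ Y ∈ namedFormats,
    drDivStripTest X Y = true ↔
    (X, Y) ∈ [(E2M1, E3M2), (E2M1, E5M2), (E2M1, Binary8p3), (E2M1, Binary8p3F), (E3M2, E4M3),
      (E3M2, Binary8p4), (E3M2, Binary8p5), (E3M2, Binary8p4F), (E2M3, Binary8p5),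
      (Binary8p5, BFloat16)] := by
  decide +kernel

/-- THE `9` STRIP CELLS FAIL BY THE LAW (`∉ drDivPairs`, `embedsTest`, `¬ DRDiv` by
`not_drDiv_of_stripTest`): e2m1 → e3m2 / e5m2 / binary8p3 / binary8p3f (`4 ÷ 3/2 = 8/3 ↦ 5/2 ↦ 2`,
directly `3`), e3m2 → e4m3 / binary8p4 / binary8p4f (`1/4 ÷ 7/16 = 4/7 ↦ 9/16 ↦ 1/2`, directly
`5/8`), e2m3 → binary8p5 (`4 ÷ 15/8 = 32/15 ↦ 17/8 ↦ 2`, directly `9/4`), binary8p5 → bfloat16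
(`1/16 ÷ 31/128 = 8/31 ↦ 33/128 ↦ 1/4`, directly `17/64`). [this packet] -/
theorem drDivStrip_cells : ∀ p ∈ [(E2M1, E3M2), (E2M1, E5M2), (E2M1, Binary8p3),
    (E2M1, Binary8p3F), (E3M2, E4M3), (E3M2, Binary8p4), (E3M2, Binary8p4F), (E2M3, Binary8p5),
    (Binary8p5, BFloat16)],
    p ∉ drDivPairs ∧ embedsTest p.1 p.2 = true ∧ ¬ DRDiv p.1 p.2 := by
  intro p hp
  simp only [List.mem_cons, List.not_mem_nil, or_false] at hp
  rcases hp with rfl | rfl | rfl | rfl | rfl | rfl | rfl | rfl | rfl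
  all_goals exact ⟨by decide +kernel, by decide +kernel, not_drDiv_of_stripTest (by decide +kernel)⟩

/-! ## §3 Classification of the named ÷ matrix, completed -/

/-- CLASSIFICATION, COMPLETED.  Every failing cell `X ⊆ Y` (`embedsTest`, `∉ drDivPairs`) of the
named ÷ matrix `drDiv_named_iff` satisfies the hypothesis of THEOREM N-div-S (`drDivStripTest`,
`9` cells) or of THEOREM N-div-E (`drDivEqNegTest`, `7` cells), never both: ALL `16` failing
embedded cells are instances of two record-generic laws; the `102` non-embedded pairs fail by
`embeds_of_drDiv_named`, and the `51` holding cells hold by clauses (I)/(G)/(Q) of `drDiv_of_test`.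
[this packet] -/
theorem drDiv_named_failing_classified : ∀ X ∈ namedFormats, ∀ Y ∈ namedFormats,
    embedsTest X Y = true → (X, Y) ∉ drDivPairs →
    (drDivStripTest X Y = true ∨ drDivEqNegTest X Y = true) ∧
      ¬ (drDivStripTest X Y = true ∧ drDivEqNegTest X Y = true) := by
  decide +kernel

/-- THE TWO LAWS DECIDE EVERY FAILING NAMED CELL: `¬ DRDiv X Y` for every failing embedded cell,
by the record-generic theorem its hypothesis selects (no witness table). [this packet] -/
theorem not_drDiv_named_of_laws : ∀ X ∈ namedFormats, ∀ Y ∈ namedFormats,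
    embedsTest X Y = true → (X, Y) ∉ drDivPairs → ¬ DRDiv X Y := by
  intro X hX Y hY he hn
  rcases (drDiv_named_failing_classified X hX Y hY he hn).1 with h | h
  · exact not_drDiv_of_stripTest h
  · exact not_drDiv_of_eqNegTest h

/-- THE NAMED ÷ MATRIX READ BY LAWS: `DRDiv X Y` iff `X ⊆ Y` and neither necessity law applies —
the `51` holding cells by `drDiv_named_iff`, the failing direction by `embeds_of_drDiv_named`,
`not_drDiv_of_stripTest` and `not_drDiv_of_eqNegTest`. [this packet] -/
theorem drDiv_named_iff_laws {X Y : Format} (hX : X ∈ namedFormats) (hY : Y ∈ namedFormats) :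
    DRDiv X Y ↔
      embedsTest X Y = true ∧ drDivStripTest X Y = false ∧ drDivEqNegTest X Y = false := by
  constructor
  · intro h
    have he := (embeds_iff_test (stdOperand_of_mem_namedFormats X hX)).mp
      (embeds_of_drDiv_named hX hY h)
    refine ⟨he, ?_, ?_⟩
    · cases hS : drDivStripTest X Y
      · rfl
      · exact absurd h (not_drDiv_of_stripTest hS)
    · cases hE : drDivEqNegTest X Y
      · rfl
      · exact absurd h (not_drDiv_of_eqNegTest hE)
  · intro h
    rw [drDiv_named_iff hX hY]
    have key : ∀ X ∈ namedFormats, ∀ Y ∈ namedFormats,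
        embedsTest X Y = true ∧ drDivStripTest X Y = false ∧ drDivEqNegTest X Y = false →
        (X, Y) ∈ drDivPairs := by
      decide +kernel
    exact key X hX Y hY h

end Summit.Ventures.CertifiedArithmetic
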